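import Literature.Analysis.FluidPDE.EulerFourierTransport
import Literature.Analysis.FluidPDE.FourierL2Nonlin
import Literature.Analysis.FluidPDE.FujitaKatoPicard
import Literature.Analysis.ODE.GlobalExistence
import Mathlib.MeasureTheory.Function.L2Space
import Mathlib.MeasureTheory.Function.LpSpace.ContinuousCompMeasurePreserving
import Mathlib.MeasureTheory.Function.ConvergenceInMeasure
import Mathlib.Analysis.InnerProductSpace.Calculus
import Mathlib.Analysis.Calculus.MeanValue
import HarnessLib

/-!
# The Fourier–Galerkin truncation of the Euler/Navier–Stokes system on `ℝ³` as an ODE on `L²`: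
# global regularised solutions (Majda–Bertozzi 2002, §3.2.2, Thm. 3.2 / Prop. 3.6, Fourier side)

Second file of the Fourier–Galerkin construction of local smooth solutions of the Euler and
Navier–Stokes equations on `ℝ³` with `H³`-controlled lifespan (discharge of
`Literature.Analysis.FluidPDE.MajdaBertozzi2002_localExistenceH3`, `NSVorticityBKM.lean`;
A. J. Majda, A. L. Bertozzi, *Vorticity and Incompressible Flow*, CUP 2002, §3.2). Majda–Bertozzi
regularise Euler/Navier–Stokes as the ODE `dv^ε/dt = F_ε(v^ε) = ν J_ε²Δv^ε − P J_ε[(J_εv^ε)·∇(J_εv^ε)]`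
((3.51)–(3.52), p. 101) on the Banach space `V^m = {v ∈ H^m : div v = 0}` ((3.49), p. 100), prove that
`F_ε` is locally Lipschitz ((3.54), p. 102), obtain local solutions from the Picard theorem
(Thm. 3.1 / Prop. 3.6 (i)), the energy bound `sup_t ‖v^ε‖₀ ≤ ‖v₀‖₀` ((3.53), from the cancellation
"the specific choice of regularization … provides a balance of terms for the integration by parts",
pp. 102–103) and global existence from the continuation principle for autonomous ODEs (Thm. 3.2
with Thm. 3.3, pp. 101–103).

This file runs the same construction on the **Fourier side** at the level `m = 0`, with the sharp
frequency cut-off `χ_R = 1_{‖ξ‖ ≤ R}` (`cutoff`) in place of the mollifier `J_ε` (`ε ∼ 1/R`) and the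
heat rate `c = 4π²ν ≥ 0`:

* the Hilbert space is `𝓗 = L²(ℝ³; ℂ³)` (Mathlib's `Lp (EuclideanSpace ℂ (Fin 3)) 2 volume`) of
  coefficient fields, with `coeff v : ℝ³ → Fin 3 → ℂ` the bridge to the tree's Fourier-side
  calculus (`FourierNS.nonlin`, `fconv`); bounded measurable real symbols act as continuous
  `ℝ`-linear operators `symMulCLM` (`⟪u, M_θ v⟫ = ∫ θ ∑_l v_l conj u_l`, `inner_symMulCLM`);
* the **phase space** `symSubspace` — divergence-free (`∑_l ξ_l v_l(ξ) = 0`) and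
  conjugation-symmetric (`v(-ξ) = conj v(ξ)`) fields a.e., the Fourier image of real divergence-free
  `L²` vector fields, MB's `V⁰` — is a closed (`isClosed_symSubspace`, via a.e. convergent
  subsequences) hence complete real subspace;
* the **Galerkin nonlinearity** `galerkinNonlin R v w = χ_R N(χ_R v, χ_R w) ∈ 𝓗` (pointwise bound
  `‖N(χ_Rv, χ_Rw)(ξ)_l‖ ≤ 36π‖ξ‖‖v‖‖w‖`, `norm_nonlin_truncCoeff_le`; `‖B_R(v,w)‖ ≤ K_R‖v‖‖w‖`,
  `norm_galerkinNonlin_le`; local Lipschitz bound `norm_galerkinNonlin_self_sub_self_le`, MB (3.54));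
  it maps the phase space into itself (`galerkinNonlin_mem_symSubspace`) and satisfies the **energy
  cancellation** `Re ⟪v, B_R(v, v)⟫ = 0` there (`re_inner_galerkinNonlin_self`, from
  `re_integral_sum_nonlin_mul_conj_eq_zero` of `EulerFourierTransport`);
* the **Galerkin field** `galerkinField c R v = -c‖ξ‖²χ_R v − B_R(v, v)` on the phase space is
  Lipschitz on balls (`lipschitzOnWith_galerkinField`) with `Re ⟪v, F_R(v)⟫ ≤ 0`
  (`re_inner_galerkinField_le`), so the energy `‖α(t)‖` of a solution is non-increasing
  (`norm_le_norm_zero_of_galerkin_solution`, MB (3.53)), and the tree's continuation principle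
  `Literature.Analysis.ODE.exists_solution_of_apriori_bound` yields **global solutions**
  `α : [0, ∞) → symSubspace` of `α' = F_R(α)`, `α(0) = a` (`exists_galerkin_solution`, MB Thm. 3.2
  on the Fourier side);
* `galerkin_solution_eq_initial_of_lt` — the solution does not move off the cut-off ball:
  `α(t)(ξ) = a(ξ)` a.e. on `‖ξ‖ > R` (the datum is kept, untruncated, beyond the cut-off, so that
  all its moments are available to the uniform estimates of the sequel files).

Uniqueness of Galerkin solutions is not recorded (not needed downstream). Solutions are taken in
the output convention of Mathlib's Picard–Lindelöf theorem and of `Literature.Analysis.ODE`: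
`∀ t ∈ Icc 0 T, HasDerivWithinAt α (F (α t)) (Icc 0 T) t`.

## Mathlib / tree search

Mathlib has no multiplication-operator API on `Lp` by bounded measurable scalar functions
(`lean search 'Lp.*mul|multiplier.*Lp'`: only `ContinuousLinearMap.compLp`, `Lp.compMeasurePreserving`,
`indicatorConstLp`), so `symMulCLM` is built with `MemLp.of_le_mul` + `LinearMap.mkContinuous`;
used: `MeasureTheory.L2.inner_def`, `PiLp.inner_apply`, `Lp.ext`, `Lp.coeFn_add/sub/smul/neg/zero`,
`tendstoInMeasure_of_tendsto_Lp`, `TendstoInMeasure.exists_seq_tendsto_ae`, `IsSeqClosed.isClosed`,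
`IsClosed.completeSpace_coe`, `memLp_indicator_const`, `integrableOn_iff_integrable_of_support_subset`,
`HasDerivWithinAt.inner`, `antitoneOn_of_deriv_nonpos`,
`Convex.norm_image_sub_le_of_norm_hasDerivWithin_le`, `inner_smul_right_eq_smul`.
Tree: `ODE.exists_solution_of_apriori_bound` (`Literature/Analysis/ODE/GlobalExistence`, pattern
of use as in `NSHopfGalerkinExistence.exists_galerkin_solution` on the torus),
`continuous_fconv_of_memLp`, `enorm_fconv_le`, `integrable_fconv_integrand` (`FourierL2Convolution`),
`nonlin_sub_left_of_memLp`, `nonlin_sub_right_of_memLp` (`FourierL2Nonlin`),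
`FujitaKato.nonlin_conj_symm_ae` (`FujitaKatoPicard`: conjugation symmetry of `N` from a.e. symmetric
inputs),
`nonlin`, `sum_mul_nonlin`, `lerayDerivSymbol_neg`, `continuous_lerayDerivSymbol`
(`NSFourierBilinear`, `NSFourierWeights`), `re_integral_sum_nonlin_mul_conj_eq_zero`
(`EulerFourierTransport`). No Fourier-side Galerkin scheme on `ℝ³` existed (`lean search
'galerkin'`: torus trigonometric-polynomial schemes `NSGalerkin*`, `EulerGalerkin*`, `KatoLaiGalerkin`).

## References

* A. J. Majda, A. L. Bertozzi, *Vorticity and Incompressible Flow*, CUP 2002: §3.2.2, (3.41)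
  (p. 99), (3.48)–(3.52) (pp. 100–101), Thm. 3.1 (pp. 99–100), Thm. 3.2, Prop. 3.6 with (3.53)
  and (3.54), Thm. 3.3 (pp. 101–103). [MajdaBertozzi2002]
-/

noncomputable section

open MeasureTheory Real Set Filter Function Metric
open scoped ENNReal NNReal ComplexConjugate InnerProductSpace
open _root_.Topology

namespace Literature.Analysis.FluidPDE.FourierNS

/-- Physical/frequency space `ℝ³`. -/
local notation "ℝ³" => EuclideanSpace ℝ (Fin 3)
/-- The fibre `ℂ³` of the coefficient fields. -/
local notation "ℂ³" => EuclideanSpace ℂ (Fin 3)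
/-- The Hilbert space `L²(ℝ³; ℂ³)` of Fourier coefficient fields. -/
local notation "𝓗" => Lp (EuclideanSpace ℂ (Fin 3)) 2 (volume : Measure (EuclideanSpace ℝ (Fin 3)))

/-! ### Coefficient fields of `L²` elements -/

section Coeff

/-- The coefficient field `ξ ↦ (l ↦ v(ξ)_l)` of an element of `L²(ℝ³; ℂ³)` (the fixed
representative `⇑v` of Mathlib's `Lp`), in the format `ℝ³ → Fin 3 → ℂ` of the tree's Fourier-side
Navier–Stokes files (`FourierNS.nonlin`, `FourierNS.fconv`). [folklore] -/
def coeff (v : 𝓗) : ℝ³ → Fin 3 → ℂ := fun ξ l => (v : ℝ³ → ℂ³) ξ l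

/-- Unfolding `coeff`. [folklore] -/
theorem coeff_apply (v : 𝓗) (ξ : ℝ³) (l : Fin 3) : coeff v ξ l = (v : ℝ³ → ℂ³) ξ l := rfl

/-- `coeff v = WithLp.ofLp ∘ ⇑v`. [folklore] -/
theorem coeff_eq_comp (v : 𝓗) : coeff v = fun ξ => WithLp.ofLp ((v : ℝ³ → ℂ³) ξ) := rfl

/-- The coefficient field is a.e. strongly measurable. [folklore] -/
theorem aestronglyMeasurable_coeff (v : 𝓗) : AEStronglyMeasurable (coeff v) volume := by
  rw [coeff_eq_comp]
  exact (EuclideanSpace.equiv (Fin 3) ℂ).continuous.comp_aestronglyMeasurable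
    (Lp.aestronglyMeasurable v)

/-- Components are bounded by the fibre norm: `‖v(ξ)_l‖ ≤ ‖v(ξ)‖`. [folklore] -/
theorem norm_coeff_le (v : 𝓗) (ξ : ℝ³) (l : Fin 3) : ‖coeff v ξ l‖ ≤ ‖(v : ℝ³ → ℂ³) ξ‖ :=
  PiLp.norm_apply_le _ l

/-- Each component of an `L²` coefficient field is square integrable. [folklore] -/
theorem memLp_coeff (v : 𝓗) (l : Fin 3) : MemLp (fun ξ => coeff v ξ l) 2 volume :=
  MemLp.of_le_mul (c := 1) (Lp.memLp v) (aesm_apply (aestronglyMeasurable_coeff v) l)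
    (Eventually.of_forall fun ξ => by rw [one_mul]; exact norm_coeff_le v ξ l)

/-- The `L²` norm of a component is bounded by the norm of `v`:
`eLpNorm (v_l) 2 ≤ ‖v‖ₑ`. [folklore] -/
theorem eLpNorm_coeff_le (v : 𝓗) (l : Fin 3) : eLpNorm (fun ξ => coeff v ξ l) 2 volume ≤ ‖v‖ₑ := by
  rw [Lp.enorm_def]
  exact eLpNorm_mono fun ξ => norm_coeff_le v ξ l

/-- Coefficients of a sum, a.e. [folklore] -/
theorem coeff_add_ae (v w : 𝓗) : ∀ᵐ ξ ∂(volume : Measure ℝ³), ∀ l,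
    coeff (v + w) ξ l = coeff v ξ l + coeff w ξ l := by
  filter_upwards [Lp.coeFn_add v w] with ξ hξ
  intro l
  simp only [coeff_apply, hξ, Pi.add_apply, PiLp.add_apply]

/-- Coefficients of a difference, a.e. [folklore] -/
theorem coeff_sub_ae (v w : 𝓗) : ∀ᵐ ξ ∂(volume : Measure ℝ³), ∀ l,
    coeff (v - w) ξ l = coeff v ξ l - coeff w ξ l := by
  filter_upwards [Lp.coeFn_sub v w] with ξ hξ
  intro l
  simp only [coeff_apply, hξ, Pi.sub_apply, PiLp.sub_apply]

/-- Coefficients of a real multiple, a.e. [folklore] -/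
theorem coeff_smul_ae (r : ℝ) (v : 𝓗) : ∀ᵐ ξ ∂(volume : Measure ℝ³), ∀ l,
    coeff (r • v) ξ l = (r : ℂ) * coeff v ξ l := by
  filter_upwards [Lp.coeFn_smul r v] with ξ hξ
  intro l
  simp only [coeff_apply, hξ, Pi.smul_apply, PiLp.smul_apply, Complex.real_smul]

/-- The fibre inner product in coefficients: `⟪v(ξ), w(ξ)⟫_ℂ = ∑_l w(ξ)_l conj v(ξ)_l`. [folklore] -/
theorem inner_fibre_eq (v w : 𝓗) (ξ : ℝ³) :
    ⟪(v : ℝ³ → ℂ³) ξ, (w : ℝ³ → ℂ³) ξ⟫_ℂ = ∑ l, coeff w ξ l * conj (coeff v ξ l) := by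
  rw [PiLp.inner_apply]
  rfl

/-- The fibre norm in coefficients: `‖v(ξ)‖² = ∑_l ‖v(ξ)_l‖²`. [folklore] -/
theorem norm_fibre_sq_eq (v : 𝓗) (ξ : ℝ³) : ‖(v : ℝ³ → ℂ³) ξ‖ ^ 2 = ∑ l, ‖coeff v ξ l‖ ^ 2 :=
  PiLp.norm_sq_eq_of_L2 _ _

/-- The inner product on `L²(ℝ³; ℂ³)` in coefficients:
`⟪v, w⟫ = ∫ ∑_l w(ξ)_l conj v(ξ)_l dξ`. [folklore] -/
theorem inner_eq_integral_coeff (v w : 𝓗) :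
    ⟪v, w⟫_ℂ = ∫ ξ, ∑ l, coeff w ξ l * conj (coeff v ξ l) := by
  rw [L2.inner_def]
  exact integral_congr_ae (Eventually.of_forall fun ξ => inner_fibre_eq v w ξ)

end Coeff

/-! ### Multiplication by bounded measurable real symbols -/

section SymMul

variable {θ : ℝ³ → ℝ} {C : ℝ}

/-- `ξ ↦ θ(ξ) v(ξ)` is in `L²` for a bounded measurable real symbol `θ`. [folklore] -/
theorem memLp_symMul (hθm : Measurable θ) (hC : ∀ ξ, |θ ξ| ≤ C) (v : 𝓗) :
    MemLp (fun ξ => ((θ ξ : ℝ) : ℂ) • (v : ℝ³ → ℂ³) ξ) 2 volume := by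
  refine MemLp.of_le_mul (c := C) (Lp.memLp v) ?_ (Eventually.of_forall fun ξ => ?_)
  · exact ((Complex.continuous_ofReal.measurable.comp hθm).aestronglyMeasurable).smul
      (Lp.aestronglyMeasurable v)
  · rw [norm_smul, Complex.norm_real, Real.norm_eq_abs]
    exact mul_le_mul_of_nonneg_right (hC ξ) (norm_nonneg _)

/-- **Multiplication by a bounded measurable real symbol** `θ` as a continuous `ℝ`-linear operator
on `L²(ℝ³; ℂ³)`: `(M_θ v)(ξ) = θ(ξ) v(ξ)`, `‖M_θ‖ ≤ C` when `|θ| ≤ C` (the Fourier multipliers of the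
Galerkin truncation: the cut-off `1_{‖ξ‖ ≤ R}`, the truncated Laplacian `‖ξ‖² 1_{‖ξ‖ ≤ R}`, the
Sobolev weights). [folklore] -/
def symMulCLM (θ : ℝ³ → ℝ) (hθm : Measurable θ) (C : ℝ) (hC : ∀ ξ, |θ ξ| ≤ C) : 𝓗 →L[ℝ] 𝓗 :=
  LinearMap.mkContinuous
    { toFun := fun v => MemLp.toLp _ (memLp_symMul hθm hC v)
      map_add' := fun v w => by
        refine Lp.ext ?_
        filter_upwards [MemLp.coeFn_toLp (memLp_symMul hθm hC (v + w)),
          MemLp.coeFn_toLp (memLp_symMul hθm hC v), MemLp.coeFn_toLp (memLp_symMul hθm hC w),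
          Lp.coeFn_add (MemLp.toLp _ (memLp_symMul hθm hC v)) (MemLp.toLp _ (memLp_symMul hθm hC w)),
          Lp.coeFn_add v w] with ξ h1 h2 h3 h4 h5
        rw [h4, Pi.add_apply, h1, h2, h3, h5, Pi.add_apply, smul_add]
      map_smul' := fun r v => by
        refine Lp.ext ?_
        filter_upwards [MemLp.coeFn_toLp (memLp_symMul hθm hC (r • v)),
          MemLp.coeFn_toLp (memLp_symMul hθm hC v),
          Lp.coeFn_smul r (MemLp.toLp _ (memLp_symMul hθm hC v)), Lp.coeFn_smul r v]
          with ξ h1 h2 h3 h4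
        rw [RingHom.id_apply, h3, Pi.smul_apply, h1, h2, h4, Pi.smul_apply, smul_comm] }
    C fun v => by
      simp only [LinearMap.coe_mk, AddHom.coe_mk, Lp.norm_toLp]
      have h := eLpNorm_le_mul_eLpNorm_of_ae_le_mul (p := 2) (c := C)
        (f := fun ξ => ((θ ξ : ℝ) : ℂ) • (v : ℝ³ → ℂ³) ξ) (g := (v : ℝ³ → ℂ³)) (μ := volume)
        (Eventually.of_forall fun ξ => by
          rw [norm_smul, Complex.norm_real, Real.norm_eq_abs]
          exact mul_le_mul_of_nonneg_right (hC ξ) (norm_nonneg _))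
      have hC0 : 0 ≤ C := le_trans (abs_nonneg _) (hC 0)
      calc (eLpNorm (fun ξ => ((θ ξ : ℝ) : ℂ) • (v : ℝ³ → ℂ³) ξ) 2 volume).toReal
          ≤ (ENNReal.ofReal C * eLpNorm (v : ℝ³ → ℂ³) 2 volume).toReal :=
            ENNReal.toReal_mono (ENNReal.mul_ne_top ENNReal.ofReal_ne_top (Lp.eLpNorm_ne_top v)) h
        _ = C * ‖v‖ := by rw [ENNReal.toReal_mul, ENNReal.toReal_ofReal hC0, Lp.norm_def]

/-- The operator `M_θ` acts by pointwise multiplication, a.e. [folklore] -/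
theorem coeFn_symMulCLM (hθm : Measurable θ) (hC : ∀ ξ, |θ ξ| ≤ C) (v : 𝓗) :
    (symMulCLM θ hθm C hC v : ℝ³ → ℂ³) =ᵐ[volume] fun ξ => ((θ ξ : ℝ) : ℂ) • (v : ℝ³ → ℂ³) ξ :=
  MemLp.coeFn_toLp (memLp_symMul hθm hC v)

/-- Coefficients of `M_θ v`, a.e.: `(M_θ v)(ξ)_l = θ(ξ) v(ξ)_l`. [folklore] -/
theorem coeff_symMulCLM_ae (hθm : Measurable θ) (hC : ∀ ξ, |θ ξ| ≤ C) (v : 𝓗) :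
    ∀ᵐ ξ ∂(volume : Measure ℝ³), ∀ l,
      coeff (symMulCLM θ hθm C hC v) ξ l = ((θ ξ : ℝ) : ℂ) * coeff v ξ l := by
  filter_upwards [coeFn_symMulCLM hθm hC v] with ξ hξ
  intro l
  simp only [coeff_apply, hξ, PiLp.smul_apply, smul_eq_mul]

/-- `‖M_θ v‖ ≤ C ‖v‖`. [folklore] -/
theorem norm_symMulCLM_apply_le (hθm : Measurable θ) (hC : ∀ ξ, |θ ξ| ≤ C) (v : 𝓗) :
    ‖symMulCLM θ hθm C hC v‖ ≤ C * ‖v‖ := by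
  have hC0 : 0 ≤ C := le_trans (abs_nonneg _) (hC 0)
  exact (symMulCLM θ hθm C hC).le_of_opNorm_le (LinearMap.mkContinuous_norm_le _ hC0 _) v

/-- **The symbol pairing**: `⟪u, M_θ v⟫ = ∫ θ(ξ) ⟪u(ξ), v(ξ)⟫ dξ = ∫ θ ∑_l v_l conj u_l`. [folklore] -/
theorem inner_symMulCLM (hθm : Measurable θ) (hC : ∀ ξ, |θ ξ| ≤ C) (u v : 𝓗) :
    ⟪u, symMulCLM θ hθm C hC v⟫_ℂ = ∫ ξ, ((θ ξ : ℝ) : ℂ) * ∑ l, coeff v ξ l * conj (coeff u ξ l) := by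
  rw [inner_eq_integral_coeff]
  refine integral_congr_ae ?_
  filter_upwards [coeff_symMulCLM_ae hθm hC v] with ξ hξ
  simp only [hξ, Finset.mul_sum]
  exact Finset.sum_congr rfl fun l _ => by ring

/-- For a non-negative symbol, `Re ⟪v, M_θ v⟫ = ∫ θ ‖v(ξ)‖² ≥ 0`. [folklore] -/
theorem re_inner_symMulCLM_self_nonneg (hθm : Measurable θ) (hC : ∀ ξ, |θ ξ| ≤ C)
    (hθ0 : ∀ ξ, 0 ≤ θ ξ) (v : 𝓗) : 0 ≤ (⟪v, symMulCLM θ hθm C hC v⟫_ℂ).re := by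
  have hsum : ∀ ξ, ∑ l, coeff v ξ l * conj (coeff v ξ l) = ((∑ l, ‖coeff v ξ l‖ ^ 2 : ℝ) : ℂ) := by
    intro ξ
    push_cast
    exact Finset.sum_congr rfl fun l _ => by
      rw [Complex.mul_conj, Complex.normSq_eq_norm_sq]; push_cast; ring
  -- integrability of the pairing integrand: `|θ| |v|² ≤ C |v|²`
  have hint : Integrable (fun ξ => ((θ ξ : ℝ) : ℂ) * ∑ l, coeff v ξ l * conj (coeff v ξ l)) volume := by
    have h2 : Integrable (fun ξ => ‖(v : ℝ³ → ℂ³) ξ‖ ^ 2) volume :=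
      (Lp.memLp v).integrable_norm_pow (by simp)
    refine (h2.const_mul C).mono' ?_ (Eventually.of_forall fun ξ => ?_)
    · refine ((Complex.continuous_ofReal.measurable.comp hθm).aestronglyMeasurable).mul ?_
      exact Finset.aestronglyMeasurable_fun_sum _ fun l _ =>
        (aesm_apply (aestronglyMeasurable_coeff v) l).mul
          (Complex.continuous_conj.comp_aestronglyMeasurable (aesm_apply (aestronglyMeasurable_coeff v) l))
    · rw [hsum, ← Complex.ofReal_mul, Complex.norm_real, Real.norm_eq_abs, abs_mul,
        ← norm_fibre_sq_eq, abs_of_nonneg (sq_nonneg ‖(v : ℝ³ → ℂ³) ξ‖)]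
      exact mul_le_mul_of_nonneg_right (hC ξ) (sq_nonneg _)
  have hre : (∫ ξ, ((θ ξ : ℝ) : ℂ) * ∑ l, coeff v ξ l * conj (coeff v ξ l)).re =
      ∫ ξ, (((θ ξ : ℝ) : ℂ) * ∑ l, coeff v ξ l * conj (coeff v ξ l)).re := by
    have h := integral_re hint
    simp only [RCLike.re_to_complex] at h
    exact h.symm
  rw [inner_symMulCLM, hre]
  refine integral_nonneg fun ξ => ?_
  simp only
  rw [hsum, ← Complex.ofReal_mul, Complex.ofReal_re]
  exact mul_nonneg (hθ0 ξ) (Finset.sum_nonneg fun l _ => sq_nonneg _)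

end SymMul

/-! ### Almost-everywhere bookkeeping for `fconv` and `nonlin` -/

section AE

variable {ι : Type*} [Fintype ι]

/-- Reflection of an a.e. property: if `P` holds a.e. then `P (-ξ)` holds a.e. [folklore] -/
theorem ae_neg {P : EuclideanSpace ℝ ι → Prop} (h : ∀ᵐ ξ ∂(volume : Measure (EuclideanSpace ℝ ι)), P ξ) :
    ∀ᵐ ξ ∂(volume : Measure (EuclideanSpace ℝ ι)), P (-ξ) :=
  (Measure.measurePreserving_neg (volume : Measure (EuclideanSpace ℝ ι))).quasiMeasurePreserving.ae h

/-- The frequency convolution only depends on the a.e. classes of its arguments. [folklore] -/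
theorem fconv_congr_ae {f f' g g' : EuclideanSpace ℝ ι → ℂ} (hf : f =ᵐ[volume] f')
    (hg : g =ᵐ[volume] g') : fconv f g = fconv f' g' := by
  funext ξ
  rw [fconv_apply, fconv_apply]
  refine integral_congr_ae ?_
  have hg' : ∀ᵐ η ∂(volume : Measure (EuclideanSpace ℝ ι)), g (ξ - η) = g' (ξ - η) :=
    (Measure.measurePreserving_sub_left volume ξ).quasiMeasurePreserving.ae hg
  filter_upwards [hf, hg'] with η h1 h2
  rw [h1, h2]

variable [DecidableEq ι]

/-- The projected nonlinearity only depends on the a.e. classes of its arguments. [folklore] -/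
theorem nonlin_congr_ae {v v' w w' : EuclideanSpace ℝ ι → ι → ℂ}
    (hv : ∀ᵐ ξ ∂(volume : Measure (EuclideanSpace ℝ ι)), v ξ = v' ξ)
    (hw : ∀ᵐ ξ ∂(volume : Measure (EuclideanSpace ℝ ι)), w ξ = w' ξ) : nonlin v w = nonlin v' w' := by
  funext ξ l
  simp only [nonlin_apply]
  congr 1
  refine Finset.sum_congr rfl fun j _ => Finset.sum_congr rfl fun k _ => ?_
  rw [fconv_congr_ae (f := (v · j)) (f' := (v' · j)) (g := (w · k)) (g' := (w' · k))]
  · filter_upwards [hv] with ξ hξ; simp only [hξ]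
  · filter_upwards [hw] with ξ hξ; simp only [hξ]

end AE

/-! ### The closed subspace of divergence-free, conjugation-symmetric fields -/

section Sym

/-- **The phase space of the Galerkin system**: `L²` coefficient fields that are divergence free
(`∑_l ξ_l v(ξ)_l = 0`) and conjugation symmetric (`v(-ξ) = conj v(ξ)`, i.e. `Re 𝓕 v` is a real
vector field and nothing is lost in taking real parts) almost everywhere — a real subspace of
`L²(ℝ³; ℂ³)`, the Fourier-side version of Majda–Bertozzi's `V⁰ = {v ∈ L² : div v = 0}` ((3.49),
p. 100). [cite: MajdaBertozzi2002, (3.49) p. 100] -/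
def symSubspace : Submodule ℝ 𝓗 where
  carrier := {v | (∀ᵐ ξ ∂(volume : Measure ℝ³), ∑ l, ((ξ l : ℝ) : ℂ) * coeff v ξ l = 0) ∧
    ∀ᵐ ξ ∂(volume : Measure ℝ³), ∀ l, coeff v (-ξ) l = conj (coeff v ξ l)}
  zero_mem' := by
    have h0 : ∀ᵐ ξ ∂(volume : Measure ℝ³), ∀ l, coeff (0 : 𝓗) ξ l = 0 := by
      filter_upwards [Lp.coeFn_zero (EuclideanSpace ℂ (Fin 3)) 2 (volume : Measure ℝ³)] with ξ hξ
      intro l; simp only [coeff_apply, hξ, Pi.zero_apply, PiLp.zero_apply]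
    constructor
    · filter_upwards [h0] with ξ hξ
      simp only [hξ, mul_zero, Finset.sum_const_zero]
    · filter_upwards [h0, ae_neg h0] with ξ hξ hξ'
      intro l; simp only [hξ, hξ', map_zero]
  add_mem' := by
    rintro v w ⟨hvd, hvs⟩ ⟨hwd, hws⟩
    constructor
    · filter_upwards [hvd, hwd, coeff_add_ae v w] with ξ h1 h2 h3
      simp only [h3, mul_add, Finset.sum_add_distrib, h1, h2, add_zero]
    · filter_upwards [hvs, hws, coeff_add_ae v w, ae_neg (coeff_add_ae v w)] with ξ h1 h2 h3 h4
      intro l; simp only [h3, h4, h1, h2, map_add]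
  smul_mem' := by
    rintro c v ⟨hvd, hvs⟩
    constructor
    · filter_upwards [hvd, coeff_smul_ae c v] with ξ h1 h2
      simp only [h2]
      calc ∑ l, ((ξ l : ℝ) : ℂ) * ((c : ℂ) * coeff v ξ l) = (c : ℂ) * ∑ l, ((ξ l : ℝ) : ℂ) * coeff v ξ l := by
            rw [Finset.mul_sum]; exact Finset.sum_congr rfl fun l _ => by ring
        _ = 0 := by rw [h1, mul_zero]
    · filter_upwards [hvs, coeff_smul_ae c v, ae_neg (coeff_smul_ae c v)] with ξ h1 h2 h3
      intro l; simp only [h2, h3, h1, map_mul, Complex.conj_ofReal]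

/-- Membership in the phase space. [folklore] -/
theorem mem_symSubspace_iff (v : 𝓗) : v ∈ symSubspace ↔
    (∀ᵐ ξ ∂(volume : Measure ℝ³), ∑ l, ((ξ l : ℝ) : ℂ) * coeff v ξ l = 0) ∧
      ∀ᵐ ξ ∂(volume : Measure ℝ³), ∀ l, coeff v (-ξ) l = conj (coeff v ξ l) := Iff.rfl

/-- **The phase space is closed** in `L²(ℝ³; ℂ³)`: a convergent sequence has an a.e. convergent
subsequence (convergence in measure), along which the two pointwise linear conditions pass to the
limit. [folklore] -/
theorem isClosed_symSubspace : IsClosed ((symSubspace : Submodule ℝ 𝓗) : Set 𝓗) := by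
  refine IsSeqClosed.isClosed fun u v hu huv => ?_
  obtain ⟨ns, -, hlim⟩ := (tendstoInMeasure_of_tendsto_Lp huv).exists_seq_tendsto_ae
  have hproj : ∀ l : Fin 3, Continuous fun x : ℂ³ => x l := fun l => (EuclideanSpace.proj l).continuous
  have hlimc : ∀ᵐ ξ ∂(volume : Measure ℝ³), ∀ l,
      Tendsto (fun i => coeff (u (ns i)) ξ l) atTop (𝓝 (coeff v ξ l)) := by
    filter_upwards [hlim] with ξ hξ
    intro l
    exact ((hproj l).tendsto _).comp hξ
  have hdiv : ∀ᵐ ξ ∂(volume : Measure ℝ³), ∀ i, ∑ l, ((ξ l : ℝ) : ℂ) * coeff (u (ns i)) ξ l = 0 :=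
    ae_all_iff.2 fun i => (hu (ns i)).1
  have hsym : ∀ᵐ ξ ∂(volume : Measure ℝ³), ∀ i, ∀ l,
      coeff (u (ns i)) (-ξ) l = conj (coeff (u (ns i)) ξ l) :=
    ae_all_iff.2 fun i => (hu (ns i)).2
  constructor
  · filter_upwards [hlimc, hdiv] with ξ hl hd
    have h1 : Tendsto (fun i => ∑ l, ((ξ l : ℝ) : ℂ) * coeff (u (ns i)) ξ l) atTop
        (𝓝 (∑ l, ((ξ l : ℝ) : ℂ) * coeff v ξ l)) :=
      tendsto_finsetSum _ fun l _ => (hl l).const_mul _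
    rw [show (fun i => ∑ l, ((ξ l : ℝ) : ℂ) * coeff (u (ns i)) ξ l) = fun _ => (0 : ℂ) from
      funext hd] at h1
    exact (tendsto_const_nhds_iff.1 h1).symm
  · filter_upwards [hlimc, ae_neg hlimc, hsym] with ξ hl hl' hs
    intro l
    have h1 : Tendsto (fun i => coeff (u (ns i)) (-ξ) l) atTop (𝓝 (coeff v (-ξ) l)) := hl' l
    have h2 : Tendsto (fun i => conj (coeff (u (ns i)) ξ l)) atTop (𝓝 (conj (coeff v ξ l))) :=
      (Complex.continuous_conj.tendsto _).comp (hl l)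
    rw [show (fun i => coeff (u (ns i)) (-ξ) l) = fun i => conj (coeff (u (ns i)) ξ l) from
      funext fun i => hs i l] at h1
    exact tendsto_nhds_unique h1 h2

/-- The phase space is complete (a closed subspace of a Hilbert space). [folklore] -/
theorem completeSpace_symSubspace : CompleteSpace (symSubspace : Submodule ℝ 𝓗) :=
  isClosed_symSubspace.completeSpace_coe

end Sym

/-! ### The sharp frequency cut-off and truncated coefficient fields -/

section Cutoff

variable {R : ℝ}

/-- The sharp frequency cut-off `χ_R(ξ) = 1_{‖ξ‖ ≤ R}` (the Fourier multiplier of the orthogonal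
projection onto band-limited fields; it plays the role of Majda–Bertozzi's mollifier `J_ε`,
`ε ∼ 1/R`). [folklore] -/
def cutoff (R : ℝ) (ξ : ℝ³) : ℝ := if ‖ξ‖ ≤ R then 1 else 0

/-- `χ_R = 1` on the ball. [folklore] -/
theorem cutoff_of_le {R : ℝ} {ξ : ℝ³} (h : ‖ξ‖ ≤ R) : cutoff R ξ = 1 := if_pos h

/-- `χ_R = 0` off the ball. [folklore] -/
theorem cutoff_of_lt {R : ℝ} {ξ : ℝ³} (h : R < ‖ξ‖) : cutoff R ξ = 0 := if_neg (not_le.2 h)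

/-- `0 ≤ χ_R ≤ 1`. [folklore] -/
theorem cutoff_nonneg (R : ℝ) (ξ : ℝ³) : 0 ≤ cutoff R ξ := by
  unfold cutoff; split_ifs <;> norm_num

/-- `χ_R ≤ 1`. [folklore] -/
theorem cutoff_le_one (R : ℝ) (ξ : ℝ³) : cutoff R ξ ≤ 1 := by
  unfold cutoff; split_ifs <;> norm_num

/-- `|χ_R| ≤ 1`. [folklore] -/
theorem abs_cutoff_le_one (R : ℝ) (ξ : ℝ³) : |cutoff R ξ| ≤ 1 := by
  rw [abs_of_nonneg (cutoff_nonneg R ξ)]; exact cutoff_le_one R ξ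

/-- `χ_R` is even. [folklore] -/
theorem cutoff_neg (R : ℝ) (ξ : ℝ³) : cutoff R (-ξ) = cutoff R ξ := by
  simp only [cutoff, norm_neg]

/-- `χ_R² = χ_R`. [folklore] -/
theorem cutoff_mul_self (R : ℝ) (ξ : ℝ³) : cutoff R ξ * cutoff R ξ = cutoff R ξ := by
  unfold cutoff; split_ifs <;> norm_num

/-- Nested cut-offs: `χ_R χ_{R'} = χ_R` for `R ≤ R'`. [folklore] -/
theorem cutoff_mul_cutoff_of_le {R R' : ℝ} (h : R ≤ R') (ξ : ℝ³) :
    cutoff R ξ * cutoff R' ξ = cutoff R ξ := by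
  unfold cutoff
  split_ifs with h1 h2
  · norm_num
  · exact absurd (h1.trans h) h2
  · norm_num
  · norm_num

/-- `χ_R` is measurable. [folklore] -/
theorem measurable_cutoff (R : ℝ) : Measurable (cutoff R) :=
  Measurable.ite (measurableSet_le continuous_norm.measurable measurable_const) measurable_const
    measurable_const

/-- **The truncated coefficient field** `χ_R v` of `v ∈ L²(ℝ³; ℂ³)` (band limitation to the ball
`‖ξ‖ ≤ R`), as a field `ℝ³ → Fin 3 → ℂ`. [folklore] -/
def truncCoeff (R : ℝ) (v : 𝓗) : ℝ³ → Fin 3 → ℂ := fun ξ l => ((cutoff R ξ : ℝ) : ℂ) * coeff v ξ l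

/-- Unfolding `truncCoeff`. [folklore] -/
theorem truncCoeff_apply (R : ℝ) (v : 𝓗) (ξ : ℝ³) (l : Fin 3) :
    truncCoeff R v ξ l = ((cutoff R ξ : ℝ) : ℂ) * coeff v ξ l := rfl

/-- The truncated field vanishes off the ball. [folklore] -/
theorem truncCoeff_of_lt {R : ℝ} (v : 𝓗) {ξ : ℝ³} (h : R < ‖ξ‖) (l : Fin 3) :
    truncCoeff R v ξ l = 0 := by
  rw [truncCoeff_apply, cutoff_of_lt h, Complex.ofReal_zero, zero_mul]

/-- On the ball the truncated field is the field. [folklore] -/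
theorem truncCoeff_of_le {R : ℝ} (v : 𝓗) {ξ : ℝ³} (h : ‖ξ‖ ≤ R) (l : Fin 3) :
    truncCoeff R v ξ l = coeff v ξ l := by
  rw [truncCoeff_apply, cutoff_of_le h, Complex.ofReal_one, one_mul]

/-- `‖(χ_R v)_l(ξ)‖ ≤ ‖v_l(ξ)‖`. [folklore] -/
theorem norm_truncCoeff_le (R : ℝ) (v : 𝓗) (ξ : ℝ³) (l : Fin 3) :
    ‖truncCoeff R v ξ l‖ ≤ ‖coeff v ξ l‖ := by
  rw [truncCoeff_apply, norm_mul, Complex.norm_real, Real.norm_eq_abs]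
  exact mul_le_of_le_one_left (norm_nonneg _) (abs_cutoff_le_one R ξ)

/-- The truncated field is a.e. strongly measurable. [folklore] -/
theorem aestronglyMeasurable_truncCoeff (R : ℝ) (v : 𝓗) :
    AEStronglyMeasurable (truncCoeff R v) volume := by
  have : truncCoeff R v = fun ξ => ((cutoff R ξ : ℝ) : ℂ) • coeff v ξ := by
    funext ξ l; simp only [truncCoeff_apply, Pi.smul_apply, smul_eq_mul]
  rw [this]
  exact ((Complex.continuous_ofReal.measurable.comp (measurable_cutoff R)).aestronglyMeasurable).smul
    (aestronglyMeasurable_coeff v)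

/-- Weighted square integrability of the truncated field for any continuous weight (all moments of
a band-limited `L²` field are finite). [folklore] -/
theorem memLp_weight_mul_truncCoeff {w : ℝ³ → ℝ} (hw : Continuous w) {B : ℝ}
    (hB : ∀ ξ : ℝ³, ‖ξ‖ ≤ R → |w ξ| ≤ B) (v : 𝓗) (l : Fin 3) :
    MemLp (fun ξ => ((w ξ : ℝ) : ℂ) * truncCoeff R v ξ l) 2 volume := by
  refine MemLp.of_le_mul (c := max B 0) (memLp_coeff v l) ?_ (Eventually.of_forall fun ξ => ?_)
  · exact ((Complex.continuous_ofReal.comp hw).aestronglyMeasurable).mul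
      (aesm_apply (aestronglyMeasurable_truncCoeff R v) l)
  · rcases le_or_gt ‖ξ‖ R with h | h
    · rw [norm_mul, Complex.norm_real, Real.norm_eq_abs, truncCoeff_of_le v h]
      exact mul_le_mul_of_nonneg_right ((hB ξ h).trans (le_max_left _ _)) (norm_nonneg _)
    · rw [truncCoeff_of_lt v h, mul_zero, norm_zero]
      exact mul_nonneg (le_max_right _ _) (norm_nonneg _)

/-- The components of the truncated field are in `L²`, with norm at most `‖v‖`. [folklore] -/
theorem memLp_truncCoeff (R : ℝ) (v : 𝓗) (l : Fin 3) : MemLp (fun ξ => truncCoeff R v ξ l) 2 volume := by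
  have h := memLp_weight_mul_truncCoeff (R := R) (w := fun _ => (1 : ℝ)) continuous_const (B := 1)
    (fun ξ _ => by simp) v l
  simpa using h

/-- `‖(χ_R v)_l‖₂ ≤ ‖v‖`. [folklore] -/
theorem eLpNorm_truncCoeff_le (R : ℝ) (v : 𝓗) (l : Fin 3) :
    eLpNorm (fun ξ => truncCoeff R v ξ l) 2 volume ≤ ‖v‖ₑ :=
  (eLpNorm_mono fun ξ => norm_truncCoeff_le R v ξ l).trans (eLpNorm_coeff_le v l)

/-- Weighted components of the truncated field are integrable (Cauchy–Schwarz on the ball of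
finite measure). [folklore] -/
theorem integrable_weight_mul_truncCoeff {w : ℝ³ → ℝ} (hw : Continuous w) (v : 𝓗) (l : Fin 3) :
    Integrable (fun ξ => ((w ξ : ℝ) : ℂ) * truncCoeff R v ξ l) volume := by
  obtain ⟨B, hB⟩ : ∃ B, ∀ ξ : ℝ³, ‖ξ‖ ≤ R → |w ξ| ≤ B := by
    obtain ⟨B, hB⟩ := (isCompact_closedBall (0 : ℝ³) R).exists_bound_of_continuousOn hw.continuousOn
    exact ⟨B, fun ξ hξ => by simpa [Real.norm_eq_abs] using hB ξ (mem_closedBall_zero_iff.2 hξ)⟩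
  have hmem := memLp_weight_mul_truncCoeff hw hB v l
  have hsupp : support (fun ξ => ((w ξ : ℝ) : ℂ) * truncCoeff R v ξ l) ⊆ closedBall (0 : ℝ³) R := by
    intro ξ hξ
    rw [mem_closedBall_zero_iff]
    by_contra h
    exact hξ (by simp only [truncCoeff_of_lt v (not_le.1 h), mul_zero])
  rw [← integrableOn_iff_integrable_of_support_subset hsupp]
  haveI : IsFiniteMeasure ((volume : Measure ℝ³).restrict (closedBall (0 : ℝ³) R)) :=
    isFiniteMeasure_restrict.2 measure_closedBall_lt_top.ne
  exact (hmem.restrict _).integrable one_le_two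

/-- The components of the truncated field are integrable. [folklore] -/
theorem integrable_truncCoeff (R : ℝ) (v : 𝓗) (l : Fin 3) :
    Integrable (fun ξ => truncCoeff R v ξ l) volume := by
  have h := integrable_weight_mul_truncCoeff (R := R) (w := fun _ => (1 : ℝ)) continuous_const v l
  simpa using h

/-- The truncated field of a phase-space element is divergence free a.e. [folklore] -/
theorem truncCoeff_divFree_ae (R : ℝ) {v : 𝓗} (hv : v ∈ symSubspace) :
    ∀ᵐ ξ ∂(volume : Measure ℝ³), ∑ l, ((ξ l : ℝ) : ℂ) * truncCoeff R v ξ l = 0 := by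
  filter_upwards [hv.1] with ξ hξ
  simp only [truncCoeff_apply]
  calc ∑ l, ((ξ l : ℝ) : ℂ) * (((cutoff R ξ : ℝ) : ℂ) * coeff v ξ l)
      = ((cutoff R ξ : ℝ) : ℂ) * ∑ l, ((ξ l : ℝ) : ℂ) * coeff v ξ l := by
        rw [Finset.mul_sum]; exact Finset.sum_congr rfl fun l _ => by ring
    _ = 0 := by rw [hξ, mul_zero]

/-- The truncated field of a phase-space element is conjugation symmetric a.e. [folklore] -/
theorem truncCoeff_conjSymm_ae (R : ℝ) {v : 𝓗} (hv : v ∈ symSubspace) :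
    ∀ᵐ ξ ∂(volume : Measure ℝ³), ∀ l, truncCoeff R v (-ξ) l = conj (truncCoeff R v ξ l) := by
  filter_upwards [hv.2] with ξ hξ
  intro l
  simp only [truncCoeff_apply, cutoff_neg, hξ l, map_mul, Complex.conj_ofReal]

/-- Truncation of a difference, a.e. [folklore] -/
theorem truncCoeff_sub_ae (R : ℝ) (v w : 𝓗) : ∀ᵐ ξ ∂(volume : Measure ℝ³),
    truncCoeff R (v - w) ξ = truncCoeff R v ξ - truncCoeff R w ξ := by
  filter_upwards [coeff_sub_ae v w] with ξ hξ
  funext l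
  simp only [truncCoeff_apply, hξ l, Pi.sub_apply, mul_sub]

end Cutoff

/-! ### The truncated nonlinearity on `L²` -/

section Nonlinearity

variable {R : ℝ}

/-- `ℓ²`-norm of a vector of `ℂ³` from a bound on its components: `‖x‖ ≤ 2B` if `‖x_l‖ ≤ B`
(`√3 ≤ 2`). [folklore] -/
theorem norm_le_two_mul_of_forall_le {x : ℂ³} {B : ℝ} (hB : 0 ≤ B) (h : ∀ l, ‖x l‖ ≤ B) :
    ‖x‖ ≤ 2 * B := by
  have hsq : ‖x‖ ^ 2 ≤ (2 * B) ^ 2 := by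
    rw [EuclideanSpace.norm_eq, Real.sq_sqrt (Finset.sum_nonneg fun l _ => sq_nonneg _)]
    calc ∑ l, ‖x l‖ ^ 2 ≤ ∑ _l : Fin 3, B ^ 2 :=
          Finset.sum_le_sum fun l _ => pow_le_pow_left₀ (norm_nonneg _) (h l) 2
      _ = 3 * B ^ 2 := by simp
      _ ≤ (2 * B) ^ 2 := by nlinarith [sq_nonneg B]
  exact (pow_le_pow_iff_left₀ (norm_nonneg _) (by positivity) two_ne_zero).1 hsq

/-- **Pointwise bound of the truncated nonlinearity**:
`‖N(χ_R v, χ_R w)(ξ)_l‖ ≤ 36π ‖ξ‖ ‖v‖ ‖w‖` (symbol bound `2‖ξ‖`, Cauchy–Schwarz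
`|(f ⋆ g)(ξ)| ≤ ‖f‖₂‖g‖₂`, nine pairs of components). [folklore] -/
theorem norm_nonlin_truncCoeff_le (R : ℝ) (v w : 𝓗) (ξ : ℝ³) (l : Fin 3) :
    ‖nonlin (truncCoeff R v) (truncCoeff R w) ξ l‖ ≤ 36 * π * ‖ξ‖ * ‖v‖ * ‖w‖ := by
  have hfc : ∀ j k, ‖fconv (truncCoeff R v · j) (truncCoeff R w · k) ξ‖ ≤ ‖v‖ * ‖w‖ := by
    intro j k
    have h1 := enorm_fconv_le (aesm_apply (aestronglyMeasurable_truncCoeff R v) j)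
      (aesm_apply (aestronglyMeasurable_truncCoeff R w) k) ξ
    have h2 : ‖fconv (truncCoeff R v · j) (truncCoeff R w · k) ξ‖ₑ ≤
        eLpNorm (v : ℝ³ → ℂ³) 2 volume * eLpNorm (w : ℝ³ → ℂ³) 2 volume := by
      refine h1.trans (mul_le_mul' ?_ ?_)
      · exact (eLpNorm_truncCoeff_le R v j).trans_eq (Lp.enorm_def v)
      · exact (eLpNorm_truncCoeff_le R w k).trans_eq (Lp.enorm_def w)
    have h3 := ENNReal.toReal_mono (ENNReal.mul_ne_top (Lp.eLpNorm_ne_top v) (Lp.eLpNorm_ne_top w)) h2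
    rwa [toReal_enorm, ENNReal.toReal_mul, ← Lp.norm_def, ← Lp.norm_def] at h3
  rw [nonlin_apply, norm_mul, norm_neg]
  have h2π : ‖(2 * π * Complex.I : ℂ)‖ = 2 * π := by
    simp [Complex.norm_real, abs_of_pos Real.pi_pos]
  rw [h2π]
  calc 2 * π * ‖∑ j, ∑ k, (lerayDerivSymbol j k l ξ : ℂ) * fconv (truncCoeff R v · j) (truncCoeff R w · k) ξ‖
      ≤ 2 * π * ∑ j, ∑ k, 2 * ‖ξ‖ * (‖v‖ * ‖w‖) := by
        gcongr
        refine (norm_sum_le _ _).trans (Finset.sum_le_sum fun j _ => (norm_sum_le _ _).trans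
          (Finset.sum_le_sum fun k _ => ?_))
        rw [norm_mul]
        exact mul_le_mul (norm_ofReal_lerayDerivSymbol_le j k l ξ) (hfc j k) (norm_nonneg _)
          (by positivity)
    _ = 36 * π * ‖ξ‖ * ‖v‖ * ‖w‖ := by simp; ring

/-- The truncated nonlinearity is continuous in the frequency (continuous symbol, convolution of
`L²` functions). [folklore] -/
theorem continuous_nonlin_truncCoeff (R : ℝ) (v w : 𝓗) (l : Fin 3) :
    Continuous fun ξ => nonlin (truncCoeff R v) (truncCoeff R w) ξ l := by
  simp only [nonlin_apply]
  refine continuous_const.mul (continuous_finsetSum _ fun j _ => continuous_finsetSum _ fun k _ => ?_)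
  exact (Complex.continuous_ofReal.comp (continuous_lerayDerivSymbol j k l)).mul
    (continuous_fconv_of_memLp (memLp_truncCoeff R v j) (memLp_truncCoeff R w k))

/-- The truncated nonlinearity as a `ℂ³`-valued function of the frequency:
`ξ ↦ χ_R(ξ) N(χ_R v, χ_R w)(ξ)`. [folklore] -/
def galerkinNonlinFun (R : ℝ) (v w : 𝓗) : ℝ³ → ℂ³ := fun ξ =>
  (EuclideanSpace.equiv (Fin 3) ℂ).symm fun l =>
    ((cutoff R ξ : ℝ) : ℂ) * nonlin (truncCoeff R v) (truncCoeff R w) ξ l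

/-- Components of the truncated nonlinearity. [folklore] -/
theorem galerkinNonlinFun_apply (R : ℝ) (v w : 𝓗) (ξ : ℝ³) (l : Fin 3) :
    galerkinNonlinFun R v w ξ l = ((cutoff R ξ : ℝ) : ℂ) * nonlin (truncCoeff R v) (truncCoeff R w) ξ l :=
  rfl

/-- The truncated nonlinearity vanishes off the ball. [folklore] -/
theorem galerkinNonlinFun_of_lt (v w : 𝓗) {ξ : ℝ³} (h : R < ‖ξ‖) : galerkinNonlinFun R v w ξ = 0 := by
  ext l
  rw [galerkinNonlinFun_apply, cutoff_of_lt h, Complex.ofReal_zero, zero_mul]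
  rfl

/-- Measurability of the truncated nonlinearity. [folklore] -/
theorem aestronglyMeasurable_galerkinNonlinFun (R : ℝ) (v w : 𝓗) :
    AEStronglyMeasurable (galerkinNonlinFun R v w) volume := by
  refine (EuclideanSpace.equiv (Fin 3) ℂ).symm.continuous.comp_aestronglyMeasurable ?_
  refine (measurable_pi_lambda _ fun l => ?_).aestronglyMeasurable
  exact (Complex.continuous_ofReal.measurable.comp (measurable_cutoff R)).mul
    (continuous_nonlin_truncCoeff R v w l).measurable

/-- **Pointwise bound**: `‖χ_R N(χ_R v, χ_R w)(ξ)‖ ≤ 72π max(R,0) ‖v‖‖w‖ · χ_R(ξ)`. [folklore] -/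
theorem norm_galerkinNonlinFun_le (R : ℝ) (v w : 𝓗) (ξ : ℝ³) :
    ‖galerkinNonlinFun R v w ξ‖ ≤ 72 * π * max R 0 * ‖v‖ * ‖w‖ * ‖cutoff R ξ‖ := by
  rcases le_or_gt ‖ξ‖ R with h | h
  · rw [Real.norm_eq_abs, abs_of_nonneg (cutoff_nonneg R ξ), cutoff_of_le h, mul_one]
    have hB : 0 ≤ 36 * π * max R 0 * ‖v‖ * ‖w‖ := by positivity
    refine (norm_le_two_mul_of_forall_le hB fun l => ?_).trans (by linarith)
    rw [galerkinNonlinFun_apply, cutoff_of_le h, Complex.ofReal_one, one_mul]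
    refine (norm_nonlin_truncCoeff_le R v w ξ l).trans ?_
    gcongr
    exact h.trans (le_max_left _ _)
  · rw [galerkinNonlinFun_of_lt v w h, norm_zero]
    positivity

/-- The cut-off is square integrable (the ball has finite measure). [folklore] -/
theorem memLp_cutoff (R : ℝ) : MemLp (fun ξ : ℝ³ => cutoff R ξ) 2 volume := by
  have h : (fun ξ : ℝ³ => cutoff R ξ) = (closedBall (0 : ℝ³) R).indicator fun _ => (1 : ℝ) := by
    funext ξ
    by_cases hξ : ‖ξ‖ ≤ R
    · rw [cutoff_of_le hξ, Set.indicator_of_mem (mem_closedBall_zero_iff.2 hξ)]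
    · rw [cutoff_of_lt (not_le.1 hξ), Set.indicator_of_notMem]
      rwa [mem_closedBall_zero_iff]
  rw [h]
  exact memLp_indicator_const 2 measurableSet_closedBall 1 (Or.inr measure_closedBall_lt_top.ne)

/-- The truncated nonlinearity is square integrable. [folklore] -/
theorem memLp_galerkinNonlinFun (R : ℝ) (v w : 𝓗) : MemLp (galerkinNonlinFun R v w) 2 volume :=
  MemLp.of_le_mul (memLp_cutoff R) (aestronglyMeasurable_galerkinNonlinFun R v w)
    (Eventually.of_forall fun ξ => norm_galerkinNonlinFun_le R v w ξ)

/-- **The Galerkin nonlinearity** `B_R(v, w) = χ_R N(χ_R v, χ_R w)` as an element of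
`L²(ℝ³; ℂ³)` — the Fourier-side counterpart of Majda–Bertozzi's `P J_ε[(J_ε v)·∇(J_ε w)]`
((3.50)–(3.52), pp. 100–101), with the sharp cut-off in place of the mollifier. [cite: MajdaBertozzi2002, (3.50)-(3.52) pp. 100-101] -/
def galerkinNonlin (R : ℝ) (v w : 𝓗) : 𝓗 := MemLp.toLp _ (memLp_galerkinNonlinFun R v w)

/-- The `L²` element `B_R(v, w)` is represented by `galerkinNonlinFun`, a.e. [folklore] -/
theorem coeFn_galerkinNonlin (R : ℝ) (v w : 𝓗) :
    (galerkinNonlin R v w : ℝ³ → ℂ³) =ᵐ[volume] galerkinNonlinFun R v w :=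
  MemLp.coeFn_toLp _

/-- Coefficients of the Galerkin nonlinearity, a.e. [folklore] -/
theorem coeff_galerkinNonlin_ae (R : ℝ) (v w : 𝓗) : ∀ᵐ ξ ∂(volume : Measure ℝ³), ∀ l,
    coeff (galerkinNonlin R v w) ξ l =
      ((cutoff R ξ : ℝ) : ℂ) * nonlin (truncCoeff R v) (truncCoeff R w) ξ l := by
  filter_upwards [coeFn_galerkinNonlin R v w] with ξ hξ
  intro l
  rw [coeff_apply, hξ, galerkinNonlinFun_apply]

/-- **Boundedness**: `‖B_R(v, w)‖ ≤ K_R ‖v‖ ‖w‖` with `K_R = 72π max(R,0) ‖χ_R‖₂`. [folklore] -/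
theorem norm_galerkinNonlin_le (R : ℝ) (v w : 𝓗) :
    ‖galerkinNonlin R v w‖ ≤
      72 * π * max R 0 * (eLpNorm (fun ξ : ℝ³ => cutoff R ξ) 2 volume).toReal * ‖v‖ * ‖w‖ := by
  rw [galerkinNonlin, Lp.norm_toLp]
  have hK : 0 ≤ 72 * π * max R 0 * ‖v‖ * ‖w‖ := by positivity
  have h := eLpNorm_le_mul_eLpNorm_of_ae_le_mul (p := 2) (μ := volume)
    (Eventually.of_forall fun ξ => norm_galerkinNonlinFun_le R v w ξ)
  calc (eLpNorm (galerkinNonlinFun R v w) 2 volume).toReal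
      ≤ (ENNReal.ofReal (72 * π * max R 0 * ‖v‖ * ‖w‖) *
          eLpNorm (fun ξ : ℝ³ => cutoff R ξ) 2 volume).toReal :=
        ENNReal.toReal_mono (ENNReal.mul_ne_top ENNReal.ofReal_ne_top (memLp_cutoff R).eLpNorm_ne_top) h
    _ = 72 * π * max R 0 * (eLpNorm (fun ξ : ℝ³ => cutoff R ξ) 2 volume).toReal * ‖v‖ * ‖w‖ := by
        rw [ENNReal.toReal_mul, ENNReal.toReal_ofReal hK]; ring

/-- **Difference of diagonal values**: `B_R(v, v) − B_R(w, w) = B_R(v − w, v) + B_R(w, v − w)`. [folklore] -/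
theorem galerkinNonlin_self_sub_self (R : ℝ) (v w : 𝓗) :
    galerkinNonlin R v v - galerkinNonlin R w w = galerkinNonlin R (v - w) v + galerkinNonlin R w (v - w) := by
  refine Lp.ext ?_
  have hsub := truncCoeff_sub_ae R v w
  have hN1 : nonlin (truncCoeff R (v - w)) (truncCoeff R v) =
      nonlin (truncCoeff R v - truncCoeff R w) (truncCoeff R v) :=
    nonlin_congr_ae hsub (Eventually.of_forall fun _ => rfl)
  have hN2 : nonlin (truncCoeff R w) (truncCoeff R (v - w)) =
      nonlin (truncCoeff R w) (truncCoeff R v - truncCoeff R w) :=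
    nonlin_congr_ae (Eventually.of_forall fun _ => rfl) hsub
  filter_upwards [Lp.coeFn_sub (galerkinNonlin R v v) (galerkinNonlin R w w),
    Lp.coeFn_add (galerkinNonlin R (v - w) v) (galerkinNonlin R w (v - w)),
    coeFn_galerkinNonlin R v v, coeFn_galerkinNonlin R w w, coeFn_galerkinNonlin R (v - w) v,
    coeFn_galerkinNonlin R w (v - w)] with ξ h1 h2 h3 h4 h5 h6
  rw [h1, h2, Pi.sub_apply, Pi.add_apply, h3, h4, h5, h6]
  ext l
  simp only [PiLp.sub_apply, PiLp.add_apply, galerkinNonlinFun_apply, hN1, hN2]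
  have hm := memLp_truncCoeff R
  rw [nonlin_sub_left_of_memLp (hm v) (hm w) (hm v) ξ, nonlin_sub_right_of_memLp (hm w) (hm v) (hm w) ξ,
    Pi.sub_apply, Pi.sub_apply]
  ring

/-- **Local Lipschitz bound of the Galerkin nonlinearity**:
`‖B_R(v,v) − B_R(w,w)‖ ≤ K_R (‖v‖ + ‖w‖) ‖v − w‖` (Majda–Bertozzi (3.54), p. 102: "so that `F_ε` is
locally Lipschitz continuous on any open set `O^M = {‖v‖ < M}`"). [cite: MajdaBertozzi2002, Prop. 3.6 proof (3.54) p. 102] -/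
theorem norm_galerkinNonlin_self_sub_self_le (R : ℝ) (v w : 𝓗) :
    ‖galerkinNonlin R v v - galerkinNonlin R w w‖ ≤
      72 * π * max R 0 * (eLpNorm (fun ξ : ℝ³ => cutoff R ξ) 2 volume).toReal *
        (‖v‖ + ‖w‖) * ‖v - w‖ := by
  rw [galerkinNonlin_self_sub_self]
  refine (norm_add_le _ _).trans ?_
  have h1 := norm_galerkinNonlin_le R (v - w) v
  have h2 := norm_galerkinNonlin_le R w (v - w)
  have hK : 0 ≤ 72 * π * max R 0 * (eLpNorm (fun ξ : ℝ³ => cutoff R ξ) 2 volume).toReal := by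
    positivity
  nlinarith [norm_nonneg (v - w), norm_nonneg v, norm_nonneg w]

/-- **The Galerkin nonlinearity maps the phase space into itself**: its values are divergence
free (the Leray symbol) and conjugation symmetric (real odd symbol, conjugation-symmetric inputs).
[folklore] -/
theorem galerkinNonlin_mem_symSubspace (R : ℝ) {v w : 𝓗} (hv : v ∈ symSubspace)
    (hw : w ∈ symSubspace) : galerkinNonlin R v w ∈ symSubspace := by
  have hc := coeff_galerkinNonlin_ae R v w
  constructor
  · filter_upwards [hc] with ξ hξ
    simp only [hξ]
    calc ∑ l, ((ξ l : ℝ) : ℂ) * (((cutoff R ξ : ℝ) : ℂ) * nonlin (truncCoeff R v) (truncCoeff R w) ξ l)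
        = ((cutoff R ξ : ℝ) : ℂ) * ∑ l, ((ξ l : ℝ) : ℂ) * nonlin (truncCoeff R v) (truncCoeff R w) ξ l := by
          rw [Finset.mul_sum]; exact Finset.sum_congr rfl fun l _ => by ring
      _ = 0 := by rw [sum_mul_nonlin, mul_zero]
  · filter_upwards [hc, ae_neg hc] with ξ h1 h2
    intro l
    rw [h1 l, h2 l, cutoff_neg, FujitaKato.nonlin_conj_symm_ae (truncCoeff_conjSymm_ae R hv)
      (truncCoeff_conjSymm_ae R hw), map_mul, Complex.conj_ofReal]

/-- **The pairing of the Galerkin nonlinearity** in coefficients: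
`⟪u, B_R(v, w)⟫ = ∫ ∑_l N(χ_R v, χ_R w)(ξ)_l conj (χ_R u)(ξ)_l dξ` (the cut-off moves onto `u`).
[folklore] -/
theorem inner_galerkinNonlin (R : ℝ) (u v w : 𝓗) :
    ⟪u, galerkinNonlin R v w⟫_ℂ =
      ∫ ξ, ∑ l, nonlin (truncCoeff R v) (truncCoeff R w) ξ l * conj (truncCoeff R u ξ l) := by
  rw [inner_eq_integral_coeff]
  refine integral_congr_ae ?_
  filter_upwards [coeff_galerkinNonlin_ae R v w] with ξ hξ
  refine Finset.sum_congr rfl fun l _ => ?_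
  rw [hξ l, truncCoeff_apply, map_mul, Complex.conj_ofReal]
  ring

/-- **The energy cancellation for the Galerkin nonlinearity**: `Re ⟪v, B_R(v, v)⟫ = 0` for `v` in
the phase space (Majda–Bertozzi, proof of (3.53), pp. 102–103: "the specific choice of the
regularization … provides a balance of terms for the integration by parts"). [cite: MajdaBertozzi2002, Prop. 3.6 (3.53) proof pp. 102-103] -/
theorem re_inner_galerkinNonlin_self (R : ℝ) {v : 𝓗} (hv : v ∈ symSubspace) :
    (⟪v, galerkinNonlin R v v⟫_ℂ).re = 0 := by
  rw [inner_galerkinNonlin]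
  exact re_integral_sum_nonlin_mul_conj_eq_zero (truncCoeff_divFree_ae R hv)
    (truncCoeff_conjSymm_ae R hv) (integrable_truncCoeff R v) (memLp_truncCoeff R v)
    (aestronglyMeasurable_truncCoeff R v) (memLp_truncCoeff R v)
    (fun k => memLp_weight_mul_truncCoeff continuous_norm (fun ξ hξ => by
      rw [abs_norm]; exact hξ) v k)
    (truncCoeff_divFree_ae R hv)

end Nonlinearity

/-! ### The Galerkin vector field on the phase space and its global flow -/

section Field

variable {c R : ℝ}

/-- The truncated Laplacian symbol `‖ξ‖² χ_R(ξ)` (Majda–Bertozzi's `J_ε² Δ`). [folklore] -/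
def viscSymbol (R : ℝ) (ξ : ℝ³) : ℝ := ‖ξ‖ ^ 2 * cutoff R ξ

/-- The truncated Laplacian symbol is non-negative. [folklore] -/
theorem viscSymbol_nonneg (R : ℝ) (ξ : ℝ³) : 0 ≤ viscSymbol R ξ :=
  mul_nonneg (sq_nonneg _) (cutoff_nonneg R ξ)

/-- The truncated Laplacian symbol is bounded by `max(R,0)²`. [folklore] -/
theorem abs_viscSymbol_le (R : ℝ) (ξ : ℝ³) : |viscSymbol R ξ| ≤ max R 0 ^ 2 := by
  rw [abs_of_nonneg (viscSymbol_nonneg R ξ), viscSymbol]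
  rcases le_or_gt ‖ξ‖ R with h | h
  · rw [cutoff_of_le h, mul_one]
    exact pow_le_pow_left₀ (norm_nonneg _) (h.trans (le_max_left _ _)) 2
  · rw [cutoff_of_lt h, mul_zero]; positivity

/-- The truncated Laplacian symbol is even. [folklore] -/
theorem viscSymbol_neg (R : ℝ) (ξ : ℝ³) : viscSymbol R (-ξ) = viscSymbol R ξ := by
  simp only [viscSymbol, norm_neg, cutoff_neg]

/-- The truncated Laplacian symbol vanishes off the ball. [folklore] -/
theorem viscSymbol_of_lt {ξ : ℝ³} (h : R < ‖ξ‖) : viscSymbol R ξ = 0 := by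
  rw [viscSymbol, cutoff_of_lt h, mul_zero]

/-- The truncated Laplacian symbol is measurable. [folklore] -/
theorem measurable_viscSymbol (R : ℝ) : Measurable (viscSymbol R) :=
  (continuous_norm.pow 2).measurable.mul (measurable_cutoff R)

/-- The truncated Laplacian `v ↦ ‖ξ‖² χ_R v` as a bounded operator on `L²(ℝ³; ℂ³)`
(Majda–Bertozzi's `J_ε²Δ`, bounded by `c/ε²`, (3.41); here by `max(R,0)²`). [cite: MajdaBertozzi2002, Prop. 3.6 proof p. 101] -/
def viscCLM (R : ℝ) : 𝓗 →L[ℝ] 𝓗 :=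
  symMulCLM (viscSymbol R) (measurable_viscSymbol R) (max R 0 ^ 2) (abs_viscSymbol_le R)

/-- The truncated Laplacian maps the phase space into itself (real even symbol). [folklore] -/
theorem viscCLM_mem_symSubspace (R : ℝ) {v : 𝓗} (hv : v ∈ symSubspace) : viscCLM R v ∈ symSubspace := by
  have hc := coeff_symMulCLM_ae (measurable_viscSymbol R) (abs_viscSymbol_le R) v
  constructor
  · filter_upwards [hv.1, hc] with ξ h1 h2
    simp only [viscCLM, h2]
    calc ∑ l, ((ξ l : ℝ) : ℂ) * (((viscSymbol R ξ : ℝ) : ℂ) * coeff v ξ l)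
        = ((viscSymbol R ξ : ℝ) : ℂ) * ∑ l, ((ξ l : ℝ) : ℂ) * coeff v ξ l := by
          rw [Finset.mul_sum]; exact Finset.sum_congr rfl fun l _ => by ring
      _ = 0 := by rw [h1, mul_zero]
  · filter_upwards [hv.2, hc, ae_neg hc] with ξ h1 h2 h3
    intro l
    simp only [viscCLM, h2 l, h3 l, viscSymbol_neg, h1 l, map_mul, Complex.conj_ofReal]

/-- The truncated Laplacian is a non-negative operator: `Re ⟪v, ‖ξ‖²χ_R v⟫ ≥ 0` (the sign of the
viscous term, MB (3.53): `+ 2ν‖∇J_εv^ε‖₀²`). [folklore] -/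
theorem re_inner_viscCLM_self_nonneg (R : ℝ) (v : 𝓗) : 0 ≤ (⟪v, viscCLM R v⟫_ℂ).re :=
  re_inner_symMulCLM_self_nonneg _ _ (viscSymbol_nonneg R) v

/-- **The Galerkin vector field** `F_R(v) = -c ‖ξ‖²χ_R v − χ_R N(χ_R v, χ_R v)` on the phase space
of divergence-free conjugation-symmetric `L²` fields — the Fourier-side rendering of
Majda–Bertozzi's `F_ε(v) = ν J_ε²Δv − P J_ε[(J_εv)·∇(J_εv)]`, (3.51)–(3.52), p. 101, with heat rate
`c = 4π²ν ≥ 0` and the sharp frequency cut-off at radius `R` in place of the mollifier `J_ε`.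
[cite: MajdaBertozzi2002, (3.51)-(3.52) p. 101] -/
def galerkinField (c R : ℝ) (v : symSubspace) : symSubspace :=
  ⟨-(c • viscCLM R (v : 𝓗)) - galerkinNonlin R (v : 𝓗) (v : 𝓗),
    Submodule.sub_mem _ (Submodule.neg_mem _ (Submodule.smul_mem _ c (viscCLM_mem_symSubspace R v.2)))
      (galerkinNonlin_mem_symSubspace R v.2 v.2)⟩

/-- The Galerkin field seen in `L²(ℝ³; ℂ³)`. [folklore] -/
theorem coe_galerkinField (c R : ℝ) (v : symSubspace) :
    (galerkinField c R v : 𝓗) = -(c • viscCLM R (v : 𝓗)) - galerkinNonlin R (v : 𝓗) (v : 𝓗) := rfl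

/-- A solution of the Galerkin system in the phase space, seen in `L²(ℝ³; ℂ³)`. [folklore] -/
theorem hasDerivWithinAt_coe_of_galerkinField {s : Set ℝ} {α : ℝ → symSubspace} {t : ℝ}
    (hα : HasDerivWithinAt α (galerkinField c R (α t)) s t) :
    HasDerivWithinAt (fun τ => (α τ : 𝓗))
      (-(c • viscCLM R (α t : 𝓗)) - galerkinNonlin R (α t : 𝓗) (α t : 𝓗)) s t :=
  symSubspace.subtypeL.hasFDerivAt.comp_hasDerivWithinAt t hα

/-- **`F_R` is Lipschitz on balls** (Majda–Bertozzi (3.54): "`F_ε` is locally Lipschitz continuous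
on any open set `O^M`"). [cite: MajdaBertozzi2002, Prop. 3.6 proof (3.54) p. 102] -/
theorem lipschitzOnWith_galerkinField (c R ρ : ℝ) :
    LipschitzOnWith (Real.toNNReal (|c| * max R 0 ^ 2 +
      72 * π * max R 0 * (eLpNorm (fun ξ : ℝ³ => cutoff R ξ) 2 volume).toReal * (2 * max ρ 0)))
      (galerkinField c R) (closedBall 0 ρ) := by
  refine LipschitzOnWith.of_dist_le_mul fun v hv w hw => ?_
  rw [mem_closedBall, dist_zero_right] at hv hw
  rw [dist_eq_norm, dist_eq_norm]
  -- pass to the ambient space (the norms agree definitionally)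
  have hvw : ‖(v : 𝓗) - (w : 𝓗)‖ = ‖v - w‖ := rfl
  have hv' : ‖(v : 𝓗)‖ ≤ max ρ 0 := hv.trans (le_max_left _ _)
  have hw' : ‖(w : 𝓗)‖ ≤ max ρ 0 := hw.trans (le_max_left _ _)
  change ‖(-(c • viscCLM R (v : 𝓗)) - galerkinNonlin R (v : 𝓗) (v : 𝓗)) -
      (-(c • viscCLM R (w : 𝓗)) - galerkinNonlin R (w : 𝓗) (w : 𝓗))‖ ≤ _ * ‖v - w‖
  set K : ℝ := 72 * π * max R 0 * (eLpNorm (fun ξ : ℝ³ => cutoff R ξ) 2 volume).toReal with hK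
  have hK0 : 0 ≤ K := by rw [hK]; positivity
  have h1 : ‖-(c • viscCLM R (v : 𝓗)) - -(c • viscCLM R (w : 𝓗))‖ ≤ |c| * max R 0 ^ 2 * ‖v - w‖ := by
    rw [neg_sub_neg, ← smul_sub, ← map_sub, norm_smul, Real.norm_eq_abs, ← hvw, mul_assoc]
    gcongr
    rw [← norm_neg, ← map_neg, neg_sub]
    exact norm_symMulCLM_apply_le _ _ _
  have h2 : ‖galerkinNonlin R (v : 𝓗) (v : 𝓗) - galerkinNonlin R (w : 𝓗) (w : 𝓗)‖ ≤
      K * (2 * max ρ 0) * ‖v - w‖ := by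
    refine (norm_galerkinNonlin_self_sub_self_le R (v : 𝓗) (w : 𝓗)).trans ?_
    rw [← hK, hvw]
    have : ‖(v : 𝓗)‖ + ‖(w : 𝓗)‖ ≤ 2 * max ρ 0 := by linarith
    gcongr
  calc ‖-(c • viscCLM R (v : 𝓗)) - galerkinNonlin R (v : 𝓗) (v : 𝓗) -
        (-(c • viscCLM R (w : 𝓗)) - galerkinNonlin R (w : 𝓗) (w : 𝓗))‖
      = ‖(-(c • viscCLM R (v : 𝓗)) - -(c • viscCLM R (w : 𝓗))) -
          (galerkinNonlin R (v : 𝓗) (v : 𝓗) - galerkinNonlin R (w : 𝓗) (w : 𝓗))‖ := by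
        congr 1; abel
    _ ≤ |c| * max R 0 ^ 2 * ‖v - w‖ + K * (2 * max ρ 0) * ‖v - w‖ := (norm_sub_le _ _).trans (add_le_add h1 h2)
    _ = (|c| * max R 0 ^ 2 + K * (2 * max ρ 0)) * ‖v - w‖ := by ring
    _ ≤ _ := by
        gcongr
        exact Real.le_coe_toNNReal _

/-- **The energy inequality for the Galerkin field**: `Re ⟪v, F_R(v)⟫ ≤ 0` for `c ≥ 0`
(Majda–Bertozzi, proof of (3.53), p. 103: `d/dt ‖v^ε‖₀² + 2ν‖∇J_εv^ε‖₀² = 0`). [cite: MajdaBertozzi2002, Prop. 3.6 (ii) (3.53) p. 101, proof pp. 102-103] -/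
theorem re_inner_galerkinField_le (hc : 0 ≤ c) (R : ℝ) (v : symSubspace) :
    (⟪(v : 𝓗), (galerkinField c R v : 𝓗)⟫_ℂ).re ≤ 0 := by
  rw [coe_galerkinField, inner_sub_right, inner_neg_right, inner_smul_right_eq_smul, Complex.sub_re,
    Complex.neg_re, Complex.smul_re, re_inner_galerkinNonlin_self R v.2, sub_zero, smul_eq_mul]
  have := re_inner_viscCLM_self_nonneg R (v : 𝓗)
  nlinarith

/-- **Energy is non-increasing along Galerkin solutions**: a solution `α` of `α' = F_R(α)` on
`[0, s]` (one-sided derivatives at the endpoints) satisfies `‖α t‖ ≤ ‖α 0‖` (Majda–Bertozzi (3.53):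
`sup_{0≤t≤T} ‖v^ε‖₀ ≤ ‖v₀‖₀`). [cite: MajdaBertozzi2002, Prop. 3.6 (ii) (3.53) p. 101] -/
theorem norm_le_norm_zero_of_galerkin_solution (hc : 0 ≤ c) (R : ℝ) {s : ℝ} {α : ℝ → symSubspace}
    (hα : ∀ t ∈ Icc 0 s, HasDerivWithinAt α (galerkinField c R (α t)) (Icc 0 s) t) {t : ℝ}
    (ht : t ∈ Icc 0 s) : ‖α t‖ ≤ ‖α 0‖ := by
  -- the ambient trajectory and its energy
  set β : ℝ → 𝓗 := fun τ => (α τ : 𝓗) with hβ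
  have hβ' : ∀ τ ∈ Icc 0 s, HasDerivWithinAt β ((galerkinField c R (α τ) : 𝓗)) (Icc 0 s) τ :=
    fun τ hτ => symSubspace.subtypeL.hasFDerivAt.comp_hasDerivWithinAt τ (hα τ hτ)
  set ψ : ℝ → ℝ := fun τ => ‖β τ‖ ^ 2 with hψ
  set ψ' : ℝ → ℝ := fun τ => 2 * (⟪β τ, (galerkinField c R (α τ) : 𝓗)⟫_ℂ).re with hψ'
  have hderiv : ∀ τ ∈ Icc 0 s, HasDerivWithinAt ψ (ψ' τ) (Icc 0 s) τ := by
    intro τ hτ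
    have h1 := (hβ' τ hτ).inner ℂ (hβ' τ hτ)
    have h2 := Complex.reCLM.hasFDerivAt.comp_hasDerivWithinAt τ h1
    have h3 : (⇑Complex.reCLM ∘ fun τ => ⟪β τ, β τ⟫_ℂ) = ψ := by
      funext τ
      rw [Function.comp_apply, Complex.reCLM_apply, hψ]
      have := inner_self_eq_norm_sq (𝕜 := ℂ) (β τ)
      simpa using this
    rw [h3] at h2
    refine h2.congr_deriv ?_
    rw [hψ']
    simp only [Complex.reCLM_apply, Complex.add_re]
    rw [← inner_conj_symm (galerkinField c R (α τ) : 𝓗) (β τ), Complex.conj_re]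
    ring
  have hψ'le : ∀ τ ∈ Icc 0 s, ψ' τ ≤ 0 := fun τ _ => by
    rw [hψ']
    have := re_inner_galerkinField_le hc R (α τ)
    linarith
  have hcont : ContinuousOn ψ (Icc 0 s) := fun τ hτ => (hderiv τ hτ).continuousWithinAt
  have hanti : AntitoneOn ψ (Icc 0 s) := by
    refine antitoneOn_of_deriv_nonpos (convex_Icc 0 s) hcont ?_ ?_
    · rw [interior_Icc]
      intro τ hτ
      exact ((hderiv τ (Ioo_subset_Icc_self hτ)).hasDerivAt (Icc_mem_nhds hτ.1 hτ.2)).differentiableAt.differentiableWithinAt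
    · rw [interior_Icc]
      intro τ hτ
      rw [((hderiv τ (Ioo_subset_Icc_self hτ)).hasDerivAt (Icc_mem_nhds hτ.1 hτ.2)).deriv]
      exact hψ'le τ (Ioo_subset_Icc_self hτ)
  have h := hanti (left_mem_Icc.2 (ht.1.trans ht.2)) ht ht.1
  have hsq : ‖α t‖ ^ 2 ≤ ‖α 0‖ ^ 2 := by
    have h0 : ψ 0 = ‖α 0‖ ^ 2 := by rw [hψ, hβ]; simp only [Submodule.coe_norm]
    have h1 : ψ t = ‖α t‖ ^ 2 := by rw [hψ, hβ]; simp only [Submodule.coe_norm]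
    rw [← h0, ← h1]; exact h
  exact (pow_le_pow_iff_left₀ (norm_nonneg _) (norm_nonneg _) two_ne_zero).1 hsq

/-- **Global existence of Galerkin solutions** (Majda–Bertozzi 2002, Thm. 3.2, p. 101: "Given an
initial condition `v₀ ∈ V^m` … for any `ε > 0` there exists for all time a unique solution
`v^ε ∈ C¹([0, ∞); V^m)` to regularized equation (3.51)", proved there by the Picard theorem on the
Banach space `V^m` (Prop. 3.6 (i)), the energy bound (3.53) and the continuation principle for
autonomous ODEs (Thm. 3.3)). Fourier side, `m = 0`: for `c ≥ 0`, every cut-off radius `R` and every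
divergence-free conjugation-symmetric `a ∈ L²(ℝ³; ℂ³)` the Galerkin system `α' = F_R(α)`,
`α(0) = a`, has a solution on `[0, ∞)` in the phase space (one-sided derivatives at `t = 0`),
obtained from the tree's continuation principle `ODE.exists_solution_of_apriori_bound` with the
Lipschitz bound `lipschitzOnWith_galerkinField` and the a priori bound
`norm_le_norm_zero_of_galerkin_solution`; uniqueness is not recorded. [cite: MajdaBertozzi2002, Thm. 3.2 p. 101 with Prop. 3.6 and Thm. 3.3 pp. 101-103] -/
theorem exists_galerkin_solution (hc : 0 ≤ c) (R : ℝ) (a : symSubspace) :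
    ∃ α : ℝ → symSubspace, α 0 = a ∧
      ∀ T, ∀ t ∈ Icc 0 T, HasDerivWithinAt α (galerkinField c R (α t)) (Icc 0 T) t := by
  haveI : CompleteSpace (symSubspace : Submodule ℝ 𝓗) := completeSpace_symSubspace
  refine ODE.exists_solution_of_apriori_bound (v := fun _ x => galerkinField c R x) (x₀ := a)
    (fun T ρ => ⟨_, fun t _ => lipschitzOnWith_galerkinField c R ρ⟩) (fun x => continuousOn_const)
    fun T _ => ⟨‖a‖, le_rfl, fun s _ α hα0 hα t ht => ?_⟩
  rw [← hα0]
  exact norm_le_norm_zero_of_galerkin_solution hc R hα ht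

/-- **Galerkin solutions do not move outside the cut-off ball**: off `‖ξ‖ ≤ R` the field `F_R`
vanishes, so `α(t) = α(0)` a.e. on `‖ξ‖ > R` (the datum is kept unchanged beyond the truncation).
[folklore] -/
theorem galerkin_solution_eq_initial_of_lt (c R : ℝ) {T : ℝ} {α : ℝ → symSubspace}
    (hα : ∀ t ∈ Icc 0 T, HasDerivWithinAt α (galerkinField c R (α t)) (Icc 0 T) t) {t : ℝ}
    (ht : t ∈ Icc 0 T) :
    ∀ᵐ ξ ∂(volume : Measure ℝ³), R < ‖ξ‖ → ((α t : 𝓗) : ℝ³ → ℂ³) ξ = ((α 0 : 𝓗) : ℝ³ → ℂ³) ξ := by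
  -- the complementary cut-off `P = M_{1 - χ_R}`
  have hθm : Measurable fun ξ : ℝ³ => 1 - cutoff R ξ := measurable_const.sub (measurable_cutoff R)
  have hθ : ∀ ξ : ℝ³, |1 - cutoff R ξ| ≤ 1 := fun ξ => by
    rw [abs_le]; constructor <;> linarith [cutoff_nonneg R ξ, cutoff_le_one R ξ]
  set P : 𝓗 →L[ℝ] 𝓗 := symMulCLM (fun ξ => 1 - cutoff R ξ) hθm 1 hθ with hP
  -- `P ∘ F_R = 0`
  have hPF : ∀ v : symSubspace, P (galerkinField c R v : 𝓗) = 0 := by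
    intro v
    refine Lp.eq_zero_iff_ae_eq_zero.2 ?_
    filter_upwards [coeFn_symMulCLM hθm hθ (galerkinField c R v : 𝓗),
      Lp.coeFn_sub (-(c • viscCLM R (v : 𝓗))) (galerkinNonlin R (v : 𝓗) (v : 𝓗)),
      Lp.coeFn_neg (c • viscCLM R (v : 𝓗)), Lp.coeFn_smul c (viscCLM R (v : 𝓗)),
      coeFn_symMulCLM (measurable_viscSymbol R) (abs_viscSymbol_le R) (v : 𝓗),
      coeFn_galerkinNonlin R (v : 𝓗) (v : 𝓗)] with ξ h1 h2 h3 h4 h5 h6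
    rw [h1, coe_galerkinField, h2, Pi.sub_apply, h3, Pi.neg_apply, h4, Pi.smul_apply, viscCLM, h5, h6,
      Pi.zero_apply]
    rcases le_or_gt ‖ξ‖ R with h | h
    · rw [cutoff_of_le h, sub_self, Complex.ofReal_zero, zero_smul]
    · rw [viscSymbol_of_lt h, galerkinNonlinFun_of_lt _ _ h, Complex.ofReal_zero, zero_smul, smul_zero,
        neg_zero, sub_zero, smul_zero]
  -- hence `P α` is constant
  set γ : ℝ → 𝓗 := fun τ => P (α τ : 𝓗) with hγ
  have hγ' : ∀ τ ∈ Icc 0 T, HasDerivWithinAt γ (0 : 𝓗) (Icc 0 T) τ := by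
    intro τ hτ
    have h := (P.comp symSubspace.subtypeL).hasFDerivAt.comp_hasDerivWithinAt τ (hα τ hτ)
    simp only [ContinuousLinearMap.comp_apply, Submodule.subtypeL_apply, hPF] at h
    exact h
  have hconst : γ t = γ 0 := by
    have h := (convex_Icc 0 T).norm_image_sub_le_of_norm_hasDerivWithin_le (C := 0) hγ'
      (fun τ _ => by rw [norm_zero]) (left_mem_Icc.2 (ht.1.trans ht.2)) ht
    rw [zero_mul, norm_le_zero_iff, sub_eq_zero] at h
    exact h
  -- read off the coefficients
  have h0 : P ((α t : 𝓗) - (α 0 : 𝓗)) = 0 := by rw [map_sub]; exact sub_eq_zero.2 hconst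
  have hae := Lp.eq_zero_iff_ae_eq_zero.1 h0
  filter_upwards [hae, coeFn_symMulCLM hθm hθ ((α t : 𝓗) - (α 0 : 𝓗)),
    Lp.coeFn_sub (α t : 𝓗) (α 0 : 𝓗)] with ξ h1 h2 h3
  intro hξ
  rw [h2, h3, Pi.sub_apply, cutoff_of_lt hξ, sub_zero, Complex.ofReal_one, one_smul, Pi.zero_apply] at h1
  exact sub_eq_zero.1 h1

end Field

end Literature.Analysis.FluidPDE.FourierNS

end
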